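import Literature.MathematicalPhysics.QuantumFieldTheory.Balaban1983to89.B4RegFieldHyps22
import Literature.MathematicalPhysics.QuantumFieldTheory.Balaban1983to89.B4Lemma22HolderCubeField

/-!
# [B4] LEMMA 2.2 FOR A GENERAL (1.7)-REGULAR CONFIGURATION `Ã` CONSTANT ON THE BOUNDARY COLLAR OF `□` — (2.17), the third
# member `G_k(□,Ã)D^{η*}_{Ã,μ}` off the corners (all `1 < p ≤ q < ∞`, the edges `p = 1 < q` and `q = ∞`), and (2.16), the
# HÖLDER member, with only «e sufficiently small» [Balaban1983RegularityDecay]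

statement-level skeleton of published theorems with citation tags; proofs where landed; nothing here is a claim about the Yang–Mills mass gap

CITATION HEADER.  T. Bałaban, *Regularity and decay of lattice Green's functions*, Commun. Math. Phys. **89** (1983)
571–597, doi:10.1007/bf01214744 [Balaban1983RegularityDecay] (cell paper B4; held text
`paper:balaban1983-cmp89-regularity-decay`, journal page = PDF page + 570; pp. 573, 577–579, 581, 583; Lemma 2.2 and
(2.14) read from the page renders `…regularity-decay-p007-x2.png`, `…-p008-x2.png`).  PDF held: yes.  Unit
`lit-balaban-p35` gen 7 (Phase-2 proof seat), HOME `run/shared/lean/pub/lit-balaban/`.  WHAT IS REPRODUCED: SKELETON row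
**B4.Lem2.2** (Lemma 2.2 (2.16) and the third member of (2.17)) for a GENERAL field satisfying the printed hypotheses —
file 3 of 4 of the general-field Lemma 2.2 (files 1–2 `B4RegFieldHyps22`, `B4Lemma22RegField`; file 4
`B4Lemma22RegFieldFam`).  Companion of gen 6/7's `B4Lemma22HolderCubeField` / `B4Lemma22EdgesCubeField` (the same at
the cube configurations `Ã_j`).  Imports `B4RegFieldHyps22` and gen 6's `B4Lemma22HolderCubeField` (`holder_gauge`,
`constBond_add_eq_bondGauge`; closure: b04's `B4Lemma22HolderBox.lemma22_16_holder_field_explicit`, the b2b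
`B4Lemma22EtaBox` dual-member theorems).

WHAT IS PRINTED (pp. 577–578, verbatim).  «(2.14) ‖f‖_{1,α} = max{sup_x |f(x)|, sup_{x,μ} |(D^η_{A,μ}f)(x)|, sup_{x,x′,μ}
(1/|x′ − x|^α)|U(A(Γ_{x,x′}))·(D^η_{A,μ}f)(x′) − (D^η_{A,μ}f)(x)|} … Lemma 2.2. … let Ã be a regular vector field
configuration in the sense of Proposition I.2.1, constant in a neighbourhood of the boundary of □. Then for e
sufficiently small and α < 1, there exists a constant c₁ depending on d, α only, such that ‖G_k(□,Ã)f‖_{1,α} ≤ c₁‖f‖_∞,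
(2.16) and a constant c₂ depending on d, p₁, such that ‖G_k(□,Ã)f‖_q, ‖D^η_{Ã,μ}G_k(□,Ã)f‖_q, ‖G_k(□,Ã)D^{η*}_{Ã,μ}f‖_q
≤ c₂‖f‖_p (2.17) for 1 ≤ p, q ≤ ∞, satisfying the condition 1/p − 1/p₁ ≤ 1/q ≤ 1/p with p₁ > d.»; p. 583: «Again by
the duality argument …»; p. 581: «by the same argument with the gauge transformation as before»; p. 573 (1.7).

WHAT THIS MODULE PROVES (setting and quantifier order as in `B4Lemma22RegField`: `C` first, then for `(c, β, S)` a
threshold `e₁`, then the instance; `(D^η_{Ã,μ})ᵀ` = the real adjoint `D^{η*}_{Ã,μ}` of the lineage's `derivA`).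
* **`lemma22_dual_regField`** — third member, `1 < p ≤ q < ∞`, `1/p − 1/q ≤ 1/p₁`: `‖G_k(□,Ã)(D^η_{Ã,μ})ᵀΦ‖_{q,η} ≤
  C‖Φ‖_{p,η}` (`B4Lemma22EtaBox.lemma22_17_weighted_box_dual` discharged).
* **`lemma22_dual_one_regField`** — third member, `p = 1 < q`, `1 − 1/q ≤ 1/p₁`: `‖G(D_Ã)ᵀΦ‖_{q,η} ≤ C‖Φ‖_{1,η}`
  (`…_box_dual_one` discharged).
* **`lemma22_dual_sup_regField`** — third member, `q = ∞`, `p₁ ≤ p < ∞`: `‖G(D_Ã)ᵀΦ‖_∞ ≤ C‖Φ‖_{p,η}` (`…_box_dual_sup`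
  discharged).
* **`lemma22_holder_regField`** — (2.16), the Hölder entry of (2.14) for `0 ≤ α < 1`: for every direction `μ`, sites
  `x ≠ x′` whose forward `μ`-bonds lie in `□`, every nearest-neighbour chain `Γ` from `x` to `x′` with
  `|Γ| ≤ (d+1)|x′ − x|_∞`: `(n/|x′ − x|_∞)^α·|U(Ã(Γ))(D^η_{Ã,μ}G_k(□,Ã)Φ)(x′) − (D^η_{Ã,μ}G_k(□,Ã)Φ)(x)| ≤ C‖Φ‖_∞`
  (b04's `B4Lemma22HolderBox.lemma22_16_holder_field_explicit` with all field hypotheses discharged — the transverse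
  Lipschitz bound `abs_comp_sub_le` from (1.7) by two staircases — and its «|κA₀,ν| ≤ θ/n» REMOVED by gauge covariance,
  gen 6's `holder_gauge` / `constBond_add_eq_bondGauge`).

HONEST SCOPE.  As `B4Lemma22RegField` (boxes, staircase block contours, collar reading, `A₀ = Ã(0)`, `e₁` depends on
`(c, β, S)`, `C` on `(d, N, flow, L, a₋, a₊, m²₊[, p₁ | α])`).  Theorems only; no `def`, no `Prop` fact, no `sorry`;
axioms standard.
-/

namespace Literature.MathematicalPhysics.QuantumFieldTheory.Balaban1983to89.B4Lemma22RegFieldDual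

open Finset Matrix
open Literature.MathematicalPhysics.QuantumFieldTheory.Balaban1983to89.B4GaugeCovariance
open Literature.MathematicalPhysics.QuantumFieldTheory.Balaban1983to89.B4Reflection242 (boxDom nbrs mem_boxDom mem_nbrs)
open Literature.MathematicalPhysics.QuantumFieldTheory.Balaban1983to89.B4Lower18Regular (e1 e1_apply_self e1_apply_ne
  baseEmb stairContour stair pathEnd_stair length_stair_le mem_stair mem_boxDom_of_between lsum stairContour_end)
open Literature.MathematicalPhysics.QuantumFieldTheory.Balaban1983to89.B4Lower18RegularRegion (compField
  pathRel_stairL_up pathRel_and pathRel_chain abs_sub_le_of_pathRel)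
open Literature.MathematicalPhysics.QuantumFieldTheory.Balaban1983to89.B4Lemma21Region (siteNorm)
open Literature.MathematicalPhysics.QuantumFieldTheory.Balaban1983to89.B4ContourShift (supNorm supNorm_nonneg
  exists_supNorm_eq abs_le_supNorm)
open Literature.MathematicalPhysics.QuantumFieldTheory.Balaban1983to89.B4Lemma22Reduce231 (supN supN_nonneg)
open Literature.MathematicalPhysics.QuantumFieldTheory.Balaban1983to89.B4Lemma22ReduceZero (Box opA greenA derivA
  supN_gauge_transpose covDeriv_gauge)
open Literature.MathematicalPhysics.QuantumFieldTheory.Balaban1983to89.B4Lemma22EtaBox (lpW lpW_nonneg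
  lemma22_17_weighted_box_dual lemma22_17_weighted_box_dual_one lemma22_17_weighted_box_dual_sup)
open Literature.MathematicalPhysics.QuantumFieldTheory.Balaban1983to89.B4Lemma22HolderBox (IsNNChain
  lemma22_16_holder_field_explicit)
open Literature.MathematicalPhysics.QuantumFieldTheory.Balaban1983to89.B4CubeFields22 (fluct fluct_step)
open Literature.MathematicalPhysics.QuantumFieldTheory.Balaban1983to89.B4CubeFieldHyps22 (greenA_smul derivA_smul
  fieldLink_smul aSeq_window cube_threshold)
open Literature.MathematicalPhysics.QuantumFieldTheory.Balaban1983to89.B4Lemma22HolderCubeField (holder_gauge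
  constBond_add_eq_bondGauge)
open Literature.MathematicalPhysics.QuantumFieldTheory.Balaban1983to89.B4Lemma22EdgesCubeField (p1_le_conjExponent)
open Literature.MathematicalPhysics.QuantumFieldTheory.Balaban1983to89.B4RegFieldHyps22

noncomputable section

variable {d : ℕ} {ι : Type} [Fintype ι] [DecidableEq ι]

/-! ## §1. The third member off the corners -/

/-- **LEMMA 2.2 (2.17), THIRD MEMBER `G_k(□,Ã)D^{η*}_{Ã,μ}`, ALL PAIRS `1 < p ≤ q < ∞` WITH `1/p − 1/q ≤ 1/p₁`, FOR A
GENERAL (1.7)-REGULAR `Ã` CONSTANT ON THE COLLAR, WITH ONLY «e SUFFICIENTLY SMALL»**: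
`‖G_k(□,Ã)(D^η_{Ã,μ})ᵀΦ‖_{q,η} ≤ C‖Φ‖_{p,η}` for every `μ` («Again by the duality argument»;
`B4Lemma22EtaBox.lemma22_17_weighted_box_dual` with every operator-side and field hypothesis DISCHARGED).
[cite: Balaban1983RegularityDecay, Lemma 2.2 (2.17) p. 578 with p. 583, (2.23) p. 579, (1.7) p. 573] -/
theorem lemma22_dual_regField (F : OrthFlow ι) {ℓ₁ : ℝ} (hℓ₁ : 0 ≤ ℓ₁)
    (hLip : ∀ t (v : ι → ℝ), ((F.U t - 1) *ᵥ v) ⬝ᵥ ((F.U t - 1) *ᵥ v) ≤ (ℓ₁ * t) ^ 2 * (v ⬝ᵥ v))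
    (d ℓ : ℕ) (hℓ : 1 ≤ ℓ) (amin aplus m2plus : ℝ) (ha : 0 < amin) {p₁ : ℝ} (hp₁ : (d : ℝ) + 1 < p₁) :
    ∃ C : ℝ, 0 < C ∧ ∀ (creg β : ℝ), 0 ≤ creg → 0 < β → ∀ (S : ℕ),
      ∃ e₁ : ℝ, 0 < e₁ ∧ ∀ (k : ℕ), 1 ≤ k → ∀ (hn : 1 ≤ (ℓ + 1) ^ k),
      ∀ (a m2 : ℝ), amin ≤ a → a ≤ aplus → 0 ≤ m2 → m2 ≤ m2plus →
      ∀ (M : Fin (d + 1) → ℕ), (∀ i, 1 ≤ M i) → (∀ i, M i ≤ S) →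
      ∀ (Ac : (Fin (d + 1) → ℤ) → Fin (d + 1) → ℝ) (e : ℝ), 0 < e → e ≤ e₁ →
        (∀ x ∈ Box d ℓ k M, ∀ μ ν : Fin (d + 1),
          |Ac (x + e1 μ) ν - Ac x ν| ≤ creg * e ^ (β - 1) / ((ℓ + 1) ^ k : ℕ)) →
        (∀ x ∈ Box d ℓ k M, ∀ μ : Fin (d + 1),
          (x μ = 0 ∨ (((ℓ + 1) ^ k * M μ : ℕ) : ℤ) ≤ x μ + 2) → ∀ ν, Ac x ν = Ac 0 ν) →
      ∀ (p q : ℝ), 1 < p → p ≤ q → p⁻¹ - q⁻¹ ≤ p₁⁻¹ →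
      ∀ (Φ : ↥(Box d ℓ k M) × ι → ℝ) (μ : Fin (d + 1)),
        lpW d ℓ k q ((greenA d F (e / ((ℓ + 1) ^ k : ℕ)) ℓ k a m2 M (baseEmb hn M) (stairContour hn M)
              (fun u v => compField Ac u.1 v.1)
            * (derivA d F (e / ((ℓ + 1) ^ k : ℕ)) ℓ k M (fun u v => compField Ac u.1 v.1) μ)ᵀ) *ᵥ Φ)
          ≤ C * lpW d ℓ k p Φ := by
  obtain ⟨c, hc, C', hC', hL⟩ := lemma22_17_weighted_box_dual F hℓ₁ hLip 1 d ℓ hℓ amin aplus m2plus ha hp₁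
  set C : ℝ := (2 + ℓ₁) * (2 * C') with hC_def
  have hC0 : 0 < C := by rw [hC_def]; positivity
  refine ⟨C, hC0, fun creg β hcreg hβ S => ?_⟩
  obtain ⟨e₁, he₁, hth⟩ := regField_threshold d (c := c) (aplus := aplus) hℓ₁ hc.le ha hcreg hβ S
  refine ⟨e₁, he₁, ?_⟩
  intro k hk hn a m2 e1' e2 e3 e4 M hM hS Ac e he hle h17 hcol p q hp hpq hσ Φ μ
  obtain ⟨hak1, hak2⟩ := aSeq_window hℓ hk ha e1' e2
  obtain ⟨hθ1, -, hsm⟩ := hth e he hle _ hak1 hak2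
  have ha' : 0 < a := lt_of_lt_of_le ha e1'
  obtain ⟨-, hunit, hθ0, hA', hθ'0, hder, hbd, hτ0, hτ⟩ :=
    regField_pkg F hℓ hk hn ha' e3 hM hS hcreg he h17 hcol (β := β)
  have hq1 : 1 < q := lt_of_lt_of_le hp hpq
  obtain ⟨-, main2⟩ := hL k hk a m2 e1' e2 e3 e4 M hM (baseEmb hn M) (stairContour hn M)
    (fun y x hw => stairContour_end hn M y x hw) (fun μ => e / ((ℓ + 1) ^ k : ℕ) * Ac 0 μ) _ _ _ _
    hunit hθ0 hA' hθ'0 hder hbd hτ0 hτ hsm p p.conjExponent q q.conjExponent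
    (Real.HolderConjugate.conjExponent hp) (Real.HolderConjugate.conjExponent hq1) hpq hσ Φ
  have hc2 : 0 ≤ 2 * C' := by positivity
  have hC2 : (1 + ℓ₁ * (((d : ℝ) + 1) * S * creg * e ^ β)) * (2 * C') ≤ C := by
    rw [hC_def]
    refine mul_le_mul_of_nonneg_right ?_ hc2
    have : ℓ₁ * (((d : ℝ) + 1) * S * creg * e ^ β) ≤ ℓ₁ * 1 := mul_le_mul_of_nonneg_left hθ1 hℓ₁
    linarith
  rw [derivA_smul, greenA_smul, smul_compField]
  exact (main2 μ).trans (mul_le_mul_of_nonneg_right hC2 (lpW_nonneg d ℓ k p Φ))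

/-- **LEMMA 2.2 (2.17), THIRD MEMBER, THE EDGE `p = 1 < q` WITH `1 − 1/q ≤ 1/p₁`, FOR A GENERAL (1.7)-REGULAR `Ã` CONSTANT
ON THE COLLAR, WITH ONLY «e SUFFICIENTLY SMALL»**: `‖G_k(□,Ã)(D^η_{Ã,μ})ᵀΦ‖_{q,η} ≤ C‖Φ‖_{1,η}` for every `μ`
(`B4Lemma22EtaBox.lemma22_17_weighted_box_dual_one` with every operator-side and field hypothesis DISCHARGED).
[cite: Balaban1983RegularityDecay, Lemma 2.2 (2.17) p. 578 with p. 583, (2.23) p. 579, (1.7) p. 573] -/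
theorem lemma22_dual_one_regField (F : OrthFlow ι) {ℓ₁ : ℝ} (hℓ₁ : 0 ≤ ℓ₁)
    (hLip : ∀ t (v : ι → ℝ), ((F.U t - 1) *ᵥ v) ⬝ᵥ ((F.U t - 1) *ᵥ v) ≤ (ℓ₁ * t) ^ 2 * (v ⬝ᵥ v))
    (d ℓ : ℕ) (hℓ : 1 ≤ ℓ) (amin aplus m2plus : ℝ) (ha : 0 < amin) {p₁ : ℝ} (hp₁ : (d : ℝ) + 1 < p₁) :
    ∃ C : ℝ, 0 < C ∧ ∀ (creg β : ℝ), 0 ≤ creg → 0 < β → ∀ (S : ℕ),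
      ∃ e₁ : ℝ, 0 < e₁ ∧ ∀ (k : ℕ), 1 ≤ k → ∀ (hn : 1 ≤ (ℓ + 1) ^ k),
      ∀ (a m2 : ℝ), amin ≤ a → a ≤ aplus → 0 ≤ m2 → m2 ≤ m2plus →
      ∀ (M : Fin (d + 1) → ℕ), (∀ i, 1 ≤ M i) → (∀ i, M i ≤ S) →
      ∀ (Ac : (Fin (d + 1) → ℤ) → Fin (d + 1) → ℝ) (e : ℝ), 0 < e → e ≤ e₁ →
        (∀ x ∈ Box d ℓ k M, ∀ μ ν : Fin (d + 1),
          |Ac (x + e1 μ) ν - Ac x ν| ≤ creg * e ^ (β - 1) / ((ℓ + 1) ^ k : ℕ)) →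
        (∀ x ∈ Box d ℓ k M, ∀ μ : Fin (d + 1),
          (x μ = 0 ∨ (((ℓ + 1) ^ k * M μ : ℕ) : ℤ) ≤ x μ + 2) → ∀ ν, Ac x ν = Ac 0 ν) →
      ∀ (q : ℝ), 1 < q → 1 - q⁻¹ ≤ p₁⁻¹ →
      ∀ (Φ : ↥(Box d ℓ k M) × ι → ℝ) (μ : Fin (d + 1)),
        lpW d ℓ k q ((greenA d F (e / ((ℓ + 1) ^ k : ℕ)) ℓ k a m2 M (baseEmb hn M) (stairContour hn M)
              (fun u v => compField Ac u.1 v.1)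
            * (derivA d F (e / ((ℓ + 1) ^ k : ℕ)) ℓ k M (fun u v => compField Ac u.1 v.1) μ)ᵀ) *ᵥ Φ)
          ≤ C * lpW d ℓ k 1 Φ := by
  obtain ⟨c, hc, C', hC', hL⟩ := lemma22_17_weighted_box_dual_one F hℓ₁ hLip 1 d ℓ hℓ amin aplus m2plus ha hp₁
  have hp₁0 : 0 < p₁ := lt_trans (by positivity) hp₁
  set C : ℝ := (2 + ℓ₁) * (2 * C') with hC_def
  have hC0 : 0 < C := by rw [hC_def]; positivity
  refine ⟨C, hC0, fun creg β hcreg hβ S => ?_⟩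
  obtain ⟨e₁, he₁, hth⟩ := regField_threshold d (c := c) (aplus := aplus) hℓ₁ hc.le ha hcreg hβ S
  refine ⟨e₁, he₁, ?_⟩
  intro k hk hn a m2 e1' e2 e3 e4 M hM hS Ac e he hle h17 hcol q hq hσ Φ μ
  obtain ⟨hak1, hak2⟩ := aSeq_window hℓ hk ha e1' e2
  obtain ⟨hθ1, -, hsm⟩ := hth e he hle _ hak1 hak2
  have ha' : 0 < a := lt_of_lt_of_le ha e1'
  obtain ⟨-, hunit, hθ0, hA', hθ'0, hder, hbd, hτ0, hτ⟩ :=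
    regField_pkg F hℓ hk hn ha' e3 hM hS hcreg he h17 hcol (β := β)
  obtain ⟨-, main2⟩ := hL k hk a m2 e1' e2 e3 e4 M hM (baseEmb hn M) (stairContour hn M)
    (fun y x hw => stairContour_end hn M y x hw) (fun μ => e / ((ℓ + 1) ^ k : ℕ) * Ac 0 μ) _ _ _ _
    hunit hθ0 hA' hθ'0 hder hbd hτ0 hτ hsm q q.conjExponent (Real.HolderConjugate.conjExponent hq)
    (p1_le_conjExponent hq hp₁0 hσ) Φ
  have hc2 : 0 ≤ 2 * C' := by positivity
  have hC2 : (1 + ℓ₁ * (((d : ℝ) + 1) * S * creg * e ^ β)) * (2 * C') ≤ C := by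
    rw [hC_def]
    refine mul_le_mul_of_nonneg_right ?_ hc2
    have : ℓ₁ * (((d : ℝ) + 1) * S * creg * e ^ β) ≤ ℓ₁ * 1 := mul_le_mul_of_nonneg_left hθ1 hℓ₁
    linarith
  rw [derivA_smul, greenA_smul, smul_compField]
  exact (main2 μ).trans (mul_le_mul_of_nonneg_right hC2 (lpW_nonneg d ℓ k 1 Φ))

/-- **LEMMA 2.2 (2.17), THIRD MEMBER, THE EDGE `q = ∞`, `p₁ ≤ p < ∞`, FOR A GENERAL (1.7)-REGULAR `Ã` CONSTANT ON THE
COLLAR, WITH ONLY «e SUFFICIENTLY SMALL»**: `‖G_k(□,Ã)(D^η_{Ã,μ})ᵀΦ‖_∞ ≤ C‖Φ‖_{p,η}` for every `μ` (the third operator of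
«bounded operators from L^{p₁}(□) … to L^∞(□)»; `B4Lemma22EtaBox.lemma22_17_weighted_box_dual_sup` discharged).
[cite: Balaban1983RegularityDecay, Lemma 2.2 (2.17) p. 578 with (2.40)–(2.41) p. 583, (2.23) p. 579, (1.7) p. 573] -/
theorem lemma22_dual_sup_regField (F : OrthFlow ι) {ℓ₁ : ℝ} (hℓ₁ : 0 ≤ ℓ₁)
    (hLip : ∀ t (v : ι → ℝ), ((F.U t - 1) *ᵥ v) ⬝ᵥ ((F.U t - 1) *ᵥ v) ≤ (ℓ₁ * t) ^ 2 * (v ⬝ᵥ v))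
    (d ℓ : ℕ) (hℓ : 1 ≤ ℓ) (amin aplus m2plus : ℝ) (ha : 0 < amin) {p₁ : ℝ} (hp₁ : (d : ℝ) + 1 < p₁) :
    ∃ C : ℝ, 0 < C ∧ ∀ (creg β : ℝ), 0 ≤ creg → 0 < β → ∀ (S : ℕ),
      ∃ e₁ : ℝ, 0 < e₁ ∧ ∀ (k : ℕ), 1 ≤ k → ∀ (hn : 1 ≤ (ℓ + 1) ^ k),
      ∀ (a m2 : ℝ), amin ≤ a → a ≤ aplus → 0 ≤ m2 → m2 ≤ m2plus →
      ∀ (M : Fin (d + 1) → ℕ), (∀ i, 1 ≤ M i) → (∀ i, M i ≤ S) →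
      ∀ (Ac : (Fin (d + 1) → ℤ) → Fin (d + 1) → ℝ) (e : ℝ), 0 < e → e ≤ e₁ →
        (∀ x ∈ Box d ℓ k M, ∀ μ ν : Fin (d + 1),
          |Ac (x + e1 μ) ν - Ac x ν| ≤ creg * e ^ (β - 1) / ((ℓ + 1) ^ k : ℕ)) →
        (∀ x ∈ Box d ℓ k M, ∀ μ : Fin (d + 1),
          (x μ = 0 ∨ (((ℓ + 1) ^ k * M μ : ℕ) : ℤ) ≤ x μ + 2) → ∀ ν, Ac x ν = Ac 0 ν) →
      ∀ (p : ℝ), p₁ ≤ p →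
      ∀ (Φ : ↥(Box d ℓ k M) × ι → ℝ) (μ : Fin (d + 1)),
        supN ((greenA d F (e / ((ℓ + 1) ^ k : ℕ)) ℓ k a m2 M (baseEmb hn M) (stairContour hn M)
              (fun u v => compField Ac u.1 v.1)
            * (derivA d F (e / ((ℓ + 1) ^ k : ℕ)) ℓ k M (fun u v => compField Ac u.1 v.1) μ)ᵀ) *ᵥ Φ)
          ≤ C * lpW d ℓ k p Φ := by
  obtain ⟨c, hc, C', hC', hL⟩ := lemma22_17_weighted_box_dual_sup F hℓ₁ hLip 1 d ℓ hℓ amin aplus m2plus ha hp₁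
  have hp₁1 : 1 < p₁ := lt_of_le_of_lt (by simp only [le_add_iff_nonneg_left]; positivity) hp₁
  set C : ℝ := (2 + ℓ₁) * (2 * C') with hC_def
  have hC0 : 0 < C := by rw [hC_def]; positivity
  refine ⟨C, hC0, fun creg β hcreg hβ S => ?_⟩
  obtain ⟨e₁, he₁, hth⟩ := regField_threshold d (c := c) (aplus := aplus) hℓ₁ hc.le ha hcreg hβ S
  refine ⟨e₁, he₁, ?_⟩
  intro k hk hn a m2 e1' e2 e3 e4 M hM hS Ac e he hle h17 hcol p hp Φ μ
  obtain ⟨hak1, hak2⟩ := aSeq_window hℓ hk ha e1' e2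
  obtain ⟨hθ1, -, hsm⟩ := hth e he hle _ hak1 hak2
  have ha' : 0 < a := lt_of_lt_of_le ha e1'
  obtain ⟨-, hunit, hθ0, hA', hθ'0, hder, hbd, hτ0, hτ⟩ :=
    regField_pkg F hℓ hk hn ha' e3 hM hS hcreg he h17 hcol (β := β)
  have hp1 : 1 < p := lt_of_lt_of_le hp₁1 hp
  obtain ⟨-, main2⟩ := hL k hk a m2 e1' e2 e3 e4 M hM (baseEmb hn M) (stairContour hn M)
    (fun y x hw => stairContour_end hn M y x hw) (fun μ => e / ((ℓ + 1) ^ k : ℕ) * Ac 0 μ) _ _ _ _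
    hunit hθ0 hA' hθ'0 hder hbd hτ0 hτ hsm p p.conjExponent (Real.HolderConjugate.conjExponent hp1) hp Φ
  have hc2 : 0 ≤ 2 * C' := by positivity
  have hC2 : (1 + ℓ₁ * (((d : ℝ) + 1) * S * creg * e ^ β)) * (2 * C') ≤ C := by
    rw [hC_def]
    refine mul_le_mul_of_nonneg_right ?_ hc2
    have : ℓ₁ * (((d : ℝ) + 1) * S * creg * e ^ β) ≤ ℓ₁ * 1 := mul_le_mul_of_nonneg_left hθ1 hℓ₁
    linarith
  rw [derivA_smul, greenA_smul, smul_compField]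
  exact (main2 μ).trans (mul_le_mul_of_nonneg_right hC2 (lpW_nonneg d ℓ k p Φ))

/-! ## §2. (2.16), the Hölder member -/

section Transverse

variable {N : Fin (d + 1) → ℕ}

omit [Fintype ι] [DecidableEq ι] in
/-- telescoping along the up-going staircase from `m` to `x ≥ m` inside the box, for any function with a step bound on
the bonds of the box: `|f(x) − f(m)| ≤ (d+1)·Kz·b` when `x_i − m_i ≤ Kz`. [folklore] -/
private theorem abs_sub_le_of_steps {f : (Fin (d + 1) → ℤ) → ℝ} {b : ℝ} (hb : 0 ≤ b)
    (hstep : ∀ p ∈ boxDom N, ∀ μ, p + e1 μ ∈ boxDom N → |f (p + e1 μ) - f p| ≤ b)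
    {m x : Fin (d + 1) → ℤ} (hm : m ∈ boxDom N) (hx : x ∈ boxDom N) (hle : m ≤ x) {Kz : ℤ}
    (hK : ∀ i, x i - m i ≤ Kz) : |f x - f m| ≤ ((d : ℝ) + 1) * Kz * b := by
  have hup : B4Lower18Regular.PathRel (fun u v : Fin (d + 1) → ℤ => ∃ μ, v = u + e1 μ) m (stair m x) :=
    pathRel_stairL_up x (List.finRange (d + 1)) m
  have hmem : ∀ z ∈ stair m x, z ∈ boxDom N := fun z hz =>
    mem_boxDom_of_between hm hx (mem_stair hle hz).1 (mem_stair hle hz).2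
  have hpath := pathRel_chain (r := fun u v : Fin (d + 1) → ℤ => ∃ μ, v = u + e1 μ)
    (P := fun z => z ∈ boxDom N) _ _ hm (pathRel_and _ _ hup hmem)
  have hst : ∀ p q : Fin (d + 1) → ℤ,
      (p ∈ boxDom N ∧ ((∃ μ, q = p + e1 μ) ∧ q ∈ boxDom N)) → |f q - f p| ≤ b := by
    rintro p q ⟨hp, ⟨μ, rfl⟩, hq⟩
    exact hstep p hp μ hq
  have htel := abs_sub_le_of_pathRel (f := f) hst _ _ hpath
  rw [pathEnd_stair hle] at htel
  have hlen : ((stair m x).length : ℝ) ≤ ((d : ℝ) + 1) * Kz := by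
    have h := length_stair_le hle (K := Kz) hK
    exact_mod_cast h
  exact htel.trans (mul_le_mul_of_nonneg_right hlen hb)

omit [Fintype ι] [DecidableEq ι] in
/-- the coordinatewise minimum of two box sites is a box site. [folklore] -/
private theorem inf_mem_boxDom {x x' : Fin (d + 1) → ℤ} (hx : x ∈ boxDom N) (hx' : x' ∈ boxDom N) :
    x ⊓ x' ∈ boxDom N := by
  rw [mem_boxDom] at hx hx' ⊢
  intro i
  rw [Pi.inf_apply]
  exact ⟨le_inf (hx i).1 (hx' i).1, lt_of_le_of_lt inf_le_left (hx i).2⟩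

omit [Fintype ι] [DecidableEq ι] in
/-- the excess of a site over the minimum is bounded by the sup distance. [folklore] -/
private theorem sub_inf_le_supNorm (x x' : Fin (d + 1) → ℤ) {Kz : ℤ} (hKz : supNorm (x' - x) = ((Kz : ℤ) : ℝ))
    (i : Fin (d + 1)) : x i - (x ⊓ x') i ≤ Kz ∧ x' i - (x ⊓ x') i ≤ Kz := by
  have h1 : (((|(x' - x) i| : ℤ)) : ℝ) ≤ supNorm (x' - x) := abs_le_supNorm (x' - x) i
  rw [hKz] at h1
  have h2 : |(x' - x) i| ≤ Kz := by exact_mod_cast h1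
  rw [Pi.sub_apply, abs_le] at h2
  rw [Pi.inf_apply]
  constructor
  · rcases le_total (x i) (x' i) with h | h
    · rw [inf_eq_left.2 h]; omega
    · rw [inf_eq_right.2 h]; omega
  · rcases le_total (x i) (x' i) with h | h
    · rw [inf_eq_left.2 h]; omega
    · rw [inf_eq_right.2 h]; omega

omit [Fintype ι] [DecidableEq ι] in
/-- **THE TRANSVERSE LIPSCHITZ BOUND OF A REGULAR FIELD** (every pair of directions): for any two sites `x, x′` of the box
and `A` with forward differences `≤ δ` on it, `|A_ν(x′) − A_ν(x)| ≤ 2(d+1)|x′ − x|_∞·δ` — two staircases through `x ⊓ x′`.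
[cite: Balaban1983RegularityDecay, (2.23) p. 579 «A′ is regular … |∂^η_μA′| ≤ c′e^{β−1}», (1.7) p. 573] -/
theorem abs_comp_sub_le {Ac : (Fin (d + 1) → ℤ) → Fin (d + 1) → ℝ} {δ : ℝ} (hδ : 0 ≤ δ)
    (h17 : ∀ x ∈ boxDom N, ∀ μ ν : Fin (d + 1), |Ac (x + e1 μ) ν - Ac x ν| ≤ δ)
    {x x' : Fin (d + 1) → ℤ} (hx : x ∈ boxDom N) (hx' : x' ∈ boxDom N) (ν : Fin (d + 1)) :
    |Ac x' ν - Ac x ν| ≤ 2 * (((d : ℝ) + 1) * supNorm (x' - x)) * δ := by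
  have hstep : ∀ p ∈ boxDom N, ∀ μ, p + e1 μ ∈ boxDom N → |Ac (p + e1 μ) ν - Ac p ν| ≤ δ :=
    fun p hp μ _ => h17 p hp μ ν
  obtain ⟨i₀, hi₀⟩ := exists_supNorm_eq (x' - x)
  set Kz : ℤ := |(x' - x) i₀| with hKz_def
  have hm : x ⊓ x' ∈ boxDom N := inf_mem_boxDom hx hx'
  have h1 : |Ac x ν - Ac (x ⊓ x') ν| ≤ ((d : ℝ) + 1) * Kz * δ :=
    abs_sub_le_of_steps (f := fun p => Ac p ν) hδ hstep hm hx inf_le_left fun i => (sub_inf_le_supNorm x x' hi₀ i).1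
  have h2 : |Ac x' ν - Ac (x ⊓ x') ν| ≤ ((d : ℝ) + 1) * Kz * δ :=
    abs_sub_le_of_steps (f := fun p => Ac p ν) hδ hstep hm hx' inf_le_right fun i => (sub_inf_le_supNorm x x' hi₀ i).2
  have hKs : (((Kz : ℤ)) : ℝ) = supNorm (x' - x) := hi₀.symm
  calc |Ac x' ν - Ac x ν| = |(Ac x' ν - Ac (x ⊓ x') ν) - (Ac x ν - Ac (x ⊓ x') ν)| := by ring_nf
    _ ≤ |Ac x' ν - Ac (x ⊓ x') ν| + |Ac x ν - Ac (x ⊓ x') ν| := abs_sub _ _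
    _ ≤ ((d : ℝ) + 1) * Kz * δ + ((d : ℝ) + 1) * Kz * δ := add_le_add h2 h1
    _ = 2 * (((d : ℝ) + 1) * supNorm (x' - x)) * δ := by rw [← hKs]; ring

end Transverse

/-- **«FOR e SUFFICIENTLY SMALL» FOR THE HÖLDER MEMBER AT A GENERAL REGULAR FIELD**: `B4RegFieldHyps22.regField_threshold`
(θ(e) ≤ 1 and the two smallness conditions) and in addition `2(d+1)θ′(e) ≤ 1` for the transverse constant.
[cite: Balaban1983RegularityDecay, Lemma 2.2 p. 577 «for e sufficiently small», p. 581] -/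
theorem holder_threshold_reg (d : ℕ) {ℓ₁ c amin aplus creg β : ℝ} (hℓ₁ : 0 ≤ ℓ₁) (hc : 0 ≤ c) (ha : 0 < amin)
    (hcreg : 0 ≤ creg) (hβ : 0 < β) (S : ℕ) :
    ∃ e₁ : ℝ, 0 < e₁ ∧ ∀ e : ℝ, 0 < e → e ≤ e₁ → ∀ ak : ℝ, 3 / 4 * amin ≤ ak → ak ≤ aplus →
      ((d : ℝ) + 1) * S * creg * e ^ β ≤ 1 ∧ 2 * ((d : ℝ) + 1) * (creg * e ^ β) ≤ 1 ∧
      ((d : ℝ) + 2) * c * (((d : ℝ) + 1) * ℓ₁ * (((d : ℝ) + 1) * S * creg * e ^ β + creg * e ^ β)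
        + ((d : ℝ) + 1) * ℓ₁ * (((d : ℝ) + 1) * S * creg * e ^ β)
        + ((d : ℝ) + 1) * ℓ₁ ^ 2 * (((d : ℝ) + 1) * S * creg * e ^ β) ^ 2
        + ak * (ℓ₁ * (((d : ℝ) + 1) * (((d : ℝ) + 1) * S * creg * e ^ β))
          * (2 + ℓ₁ * (((d : ℝ) + 1) * (((d : ℝ) + 1) * S * creg * e ^ β))))) ≤ 1 / 2 := by
  obtain ⟨e₁, he₁, h1⟩ := regField_threshold d (c := c) (aplus := aplus) hℓ₁ hc ha hcreg hβ S
  obtain ⟨e₂, he₂, h2⟩ := cube_threshold (C := 2 * ((d : ℝ) + 1) * creg) (C' := 0) (t := 1) (by positivity)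
    one_pos hβ
  refine ⟨min e₁ e₂, lt_min he₁ he₂, fun e he hle ak hak1 hak2 => ?_⟩
  obtain ⟨hθ1, -, hS2⟩ := h1 e he (hle.trans (min_le_left _ _)) ak hak1 hak2
  obtain ⟨hT, -⟩ := h2 e he (hle.trans (min_le_right _ _))
  refine ⟨hθ1, ?_, hS2⟩
  calc 2 * ((d : ℝ) + 1) * (creg * e ^ β) = 2 * ((d : ℝ) + 1) * creg * e ^ β := by ring
    _ ≤ 1 := hT

/-- the zero constant configuration is the zero bond function. [folklore] -/
private theorem constBond_zero {X : Type*} (pos : X → Fin (d + 1) → ℤ) :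
    constBond (0 : Fin (d + 1) → ℝ) pos = 0 := by
  funext u v
  simp [constBond]

/-- **LEMMA 2.2 (2.16), HÖLDER MEMBER, FOR A GENERAL (1.7)-REGULAR `Ã` CONSTANT ON THE COLLAR, WITH ONLY «e SUFFICIENTLY
SMALL»**: there is `C > 0` (for `0 ≤ α < 1`; Lemma 2.2 at charge `1`) such that for every `(c, β)`, `β > 0` and side
bound `S` there is `e₁ > 0` with: for every mesh, `a, m²` of the windows, box `□ = Π_μ[0, nM_μ)` (`1 ≤ M_μ ≤ S`), every
`Ã` (1.7)-regular on `□` and constant on the collar, `0 < e ≤ e₁`, every direction `μ`, sites `x ≠ x′` whose forward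
`μ`-bonds lie in `□`, every nearest-neighbour chain `Γ` from `x` to `x′` with `|Γ| ≤ (d+1)|x′ − x|_∞` and every `Φ`:
`(n/|x′ − x|_∞)^α·|U(Ã(Γ))(D^η_{Ã,μ}G_k(□,Ã)Φ)(x′) − (D^η_{Ã,μ}G_k(□,Ã)Φ)(x)| ≤ C‖Φ‖_∞` (coupling `e/n`, staircase
block contours). [cite: Balaban1983RegularityDecay, Lemma 2.2 (2.16) p. 578 with (2.14) p. 577, (2.23) p. 579, (1.7) p. 573, p. 581] -/
theorem lemma22_holder_regField (F : OrthFlow ι) {ℓ₁ : ℝ} (hℓ₁ : 0 ≤ ℓ₁)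
    (hLip : ∀ t (v : ι → ℝ), ((F.U t - 1) *ᵥ v) ⬝ᵥ ((F.U t - 1) *ᵥ v) ≤ (ℓ₁ * t) ^ 2 * (v ⬝ᵥ v))
    (d ℓ : ℕ) (hℓ : 1 ≤ ℓ) (amin aplus m2plus : ℝ) (ha : 0 < amin) (α : ℝ) (hα0 : 0 ≤ α) (hα1 : α < 1) :
    ∃ C : ℝ, 0 < C ∧ ∀ (creg β : ℝ), 0 ≤ creg → 0 < β → ∀ (S : ℕ),
      ∃ e₁ : ℝ, 0 < e₁ ∧ ∀ (k : ℕ), 1 ≤ k → ∀ (hn : 1 ≤ (ℓ + 1) ^ k),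
      ∀ (a m2 : ℝ), amin ≤ a → a ≤ aplus → 0 ≤ m2 → m2 ≤ m2plus →
      ∀ (M : Fin (d + 1) → ℕ), (∀ i, 1 ≤ M i) → (∀ i, M i ≤ S) →
      ∀ (Ac : (Fin (d + 1) → ℤ) → Fin (d + 1) → ℝ) (e : ℝ), 0 < e → e ≤ e₁ →
        (∀ x ∈ Box d ℓ k M, ∀ μ ν : Fin (d + 1),
          |Ac (x + e1 μ) ν - Ac x ν| ≤ creg * e ^ (β - 1) / ((ℓ + 1) ^ k : ℕ)) →
        (∀ x ∈ Box d ℓ k M, ∀ μ : Fin (d + 1),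
          (x μ = 0 ∨ (((ℓ + 1) ^ k * M μ : ℕ) : ℤ) ≤ x μ + 2) → ∀ ν, Ac x ν = Ac 0 ν) →
      ∀ (μ : Fin (d + 1)) (x xe x' xe' : ↥(Box d ℓ k M)),
        xe.1 = x.1 + e1 μ → xe'.1 = x'.1 + e1 μ → x'.1 ≠ x.1 →
      ∀ (l : List ↥(Box d ℓ k M)), IsNNChain x l → pathEnd x l = x' →
        (l.length : ℝ) ≤ ((d : ℝ) + 1) * supNorm (x'.1 - x.1) →
      ∀ Φ : ↥(Box d ℓ k M) × ι → ℝ,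
        ((((ℓ + 1) ^ k : ℕ) : ℝ) / supNorm (x'.1 - x.1)) ^ α *
          siteNorm (transport (fieldLink F (e / ((ℓ + 1) ^ k : ℕ)) (fun u v => compField Ac u.1 v.1)) x l
              *ᵥ fld (derivA d F (e / ((ℓ + 1) ^ k : ℕ)) ℓ k M (fun u v => compField Ac u.1 v.1) μ
                    *ᵥ (greenA d F (e / ((ℓ + 1) ^ k : ℕ)) ℓ k a m2 M (baseEmb hn M) (stairContour hn M)
                        (fun u v => compField Ac u.1 v.1) *ᵥ Φ)) x'
            - fld (derivA d F (e / ((ℓ + 1) ^ k : ℕ)) ℓ k M (fun u v => compField Ac u.1 v.1) μ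
                    *ᵥ (greenA d F (e / ((ℓ + 1) ^ k : ℕ)) ℓ k a m2 M (baseEmb hn M) (stairContour hn M)
                        (fun u v => compField Ac u.1 v.1) *ᵥ Φ)) x)
          ≤ C * supN Φ := by
  obtain ⟨c, c₁, hc, hc₁, hL⟩ := lemma22_16_holder_field_explicit F hℓ₁ hLip 1 d ℓ hℓ amin aplus m2plus ha α hα0 hα1
  refine ⟨2 * c₁, by positivity, fun creg β hcreg hβ S => ?_⟩
  obtain ⟨e₁, he₁, hth⟩ := holder_threshold_reg d (c := c) (aplus := aplus) hℓ₁ hc.le ha hcreg hβ S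
  refine ⟨e₁, he₁, ?_⟩
  intro k hk hn a m2 e1' e2 e3 e4 M hM hS Ac e he hle h17 hcol μ x xe x' xe' hxe hxe' hne l hl hlend hlen Φ
  have hnr : (0 : ℝ) < ((ℓ + 1) ^ k : ℕ) := by exact_mod_cast hn
  -- the scaled fluctuation, the scaled constant part, the sizes
  set A' : ↥(Box d ℓ k M) → ↥(Box d ℓ k M) → ℝ :=
    fun u v => e / ((ℓ + 1) ^ k : ℕ) * fluct (Box d ℓ k M) (Ac 0) Ac u v with hA'_def
  set A₀' : Fin (d + 1) → ℝ := fun ν => e / ((ℓ + 1) ^ k : ℕ) * Ac 0 ν with hA₀'_def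
  set θ : ℝ := ((d : ℝ) + 1) * S * creg * e ^ β with hθ_def
  set θ₂ : ℝ := creg * e ^ β with hθ₂_def
  -- the window, the threshold, the field hypotheses
  obtain ⟨hak1, hak2⟩ := aSeq_window hℓ hk ha e1' e2
  obtain ⟨hθ1, hθT1, hsm⟩ := hth e he hle _ hak1 hak2
  obtain ⟨-, hA', hder, hbd⟩ := regField_hyps (d := d) hn hM hS hcreg he h17 hcol (β := β)
  have hA'2 : ∀ x y : ↥(Box d ℓ k M), y.1 ∈ nbrs x.1 → |1 * A' x y| ≤ θ / ((ℓ + 1) ^ k : ℕ) := hA'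
  have hder2 : ∀ (x z y : ↥(Box d ℓ k M)) (μ : Fin (d + 1)), z.1 = x.1 + e1 μ → y.1 = z.1 + e1 μ →
      |1 * (A' y z - A' z x)| ≤ θ₂ / (((ℓ + 1) ^ k : ℕ) : ℝ) ^ 2 ∧
      |1 * (A' x z - A' z y)| ≤ θ₂ / (((ℓ + 1) ^ k : ℕ) : ℝ) ^ 2 := hder
  have hbd2 : ∀ (x y : ↥(Box d ℓ k M)) (μ : Fin (d + 1)), y.1 = x.1 + e1 μ →
      (x.1 - e1 μ ∉ Box d ℓ k M ∨ y.1 + e1 μ ∉ Box d ℓ k M) → A' x y = 0 ∧ A' y x = 0 := hbd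
  have heβ : 0 ≤ e ^ β := (Real.rpow_pos_of_pos he β).le
  have hθ0 : 0 ≤ θ := by rw [hθ_def]; positivity
  have hθ₂0 : 0 ≤ θ₂ := by rw [hθ₂_def]; positivity
  have hθT0 : 0 ≤ 2 * ((d : ℝ) + 1) * θ₂ := by positivity
  have ha' : 0 < a := lt_of_lt_of_le ha e1'
  -- invertibility (gen 4) at the fluctuation field
  have hunit : IsUnit (opA d F 1 ℓ k a m2 M (baseEmb hn M) (stairContour hn M)
      (constBond (0 : Fin (d + 1) → ℝ) Subtype.val + A')).det :=
    B4Lemma22Invertible.opA_stair_isUnit_det F 1 hℓ hk hn ha' e3 M _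
  -- the vacuous size of the zero constant part
  have hA0 : ∀ ν, |1 * (0 : Fin (d + 1) → ℝ) ν| ≤ θ / ((ℓ + 1) ^ k : ℕ) := fun ν => by
    rw [Pi.zero_apply, mul_zero, abs_zero]; positivity
  -- the transverse Lipschitz bound
  have hδ : 0 ≤ creg * e ^ (β - 1) / ((ℓ + 1) ^ k : ℕ) := by positivity
  have hA'' : ∀ (ν : Fin (d + 1)) (u ue u' ue' : ↥(Box d ℓ k M)), ue.1 = u.1 + e1 ν → ue'.1 = u'.1 + e1 ν →
      |1 * (A' u' ue' - A' u ue)|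
        ≤ 2 * ((d : ℝ) + 1) * θ₂ * supNorm (u'.1 - u.1) / (((ℓ + 1) ^ k : ℕ) : ℝ) ^ 2 := by
    intro ν u ue u' ue' hue hue'
    have hb := abs_comp_sub_le (N := fun i => (ℓ + 1) ^ k * M i) hδ h17 u.2 u'.2 ν
    rw [one_mul, hA'_def]
    dsimp only
    rw [fluct_step (Ac 0) Ac hue, fluct_step (Ac 0) Ac hue', ← mul_sub,
      show Ac u'.1 ν - Ac 0 ν - (Ac u.1 ν - Ac 0 ν) = Ac u'.1 ν - Ac u.1 ν by ring,
      abs_mul, abs_of_pos (by positivity : (0 : ℝ) < e / ((ℓ + 1) ^ k : ℕ))]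
    calc e / ((ℓ + 1) ^ k : ℕ) * |Ac u'.1 ν - Ac u.1 ν|
        ≤ e / ((ℓ + 1) ^ k : ℕ) * (2 * (((d : ℝ) + 1) * supNorm (u'.1 - u.1))
            * (creg * e ^ (β - 1) / ((ℓ + 1) ^ k : ℕ))) := mul_le_mul_of_nonneg_left hb (by positivity)
      _ = 2 * ((d : ℝ) + 1) * (creg * (e * e ^ (β - 1))) * supNorm (u'.1 - u.1) / (((ℓ + 1) ^ k : ℕ) : ℝ) ^ 2 := by
          field_simp
      _ = 2 * ((d : ℝ) + 1) * θ₂ * supNorm (u'.1 - u.1) / (((ℓ + 1) ^ k : ℕ) : ℝ) ^ 2 := by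
          rw [hθ₂_def, Real.rpow_sub_one he.ne', mul_div_cancel₀ _ he.ne']
  -- the contour sums along the staircases
  have hτ : ∀ y x, blkWt ((ℓ + 1) ^ k) M (fun i => (ℓ + 1) ^ k * M i) y x ≠ 0 →
      |1 * lsum A' (baseEmb hn M y) (stairContour hn M y x)| ≤ ((d : ℝ) + 1) * θ :=
    fun y x _ => B4Lemma22SupStair.stair_lsum_le 1 hn M hθ0 hA'2 y x
  have hτ0 : 0 ≤ ((d : ℝ) + 1) * θ := by positivity
  -- the gauge that puts the constant part back
  set σ : ↥(Box d ℓ k M) → ℝ := linGauge A₀' Subtype.val with hσ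
  set g : ↥(Box d ℓ k M) → Matrix ι ι ℝ := fun u => F.U (1 * σ u) with hg_def
  have hg : IsGauge g := F.isGauge _
  -- the lineage's certificate at charge 1, constant part 0, fluctuation A', source 𝒢ᵀΦ
  have main := hL k hk a m2 e1' e2 e3 e4 M hM (baseEmb hn M) (stairContour hn M)
    (fun y x hw => stairContour_end hn M y x hw) 0 A' θ (2 * ((d : ℝ) + 1) * θ₂) θ₂ (((d : ℝ) + 1) * θ)
    hunit hθ0 hθ1 hA0 hA'2 hθT0 hθT1 hA'' hθ₂0 hder2 hbd2 hτ0 hτ hsm μ x xe x' xe' hxe hxe' hne l hl hlend hlen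
    ((blockDiag g)ᵀ *ᵥ Φ)
  rw [constBond_zero, zero_add, supN_gauge_transpose hg] at main
  -- put back the charge and the constant part: (e/n)Ã = (A')^σ
  have hfield : (fun u v : ↥(Box d ℓ k M) => e / ((ℓ + 1) ^ k : ℕ) * compField Ac u.1 v.1) = bondGauge σ A' := by
    rw [smul_compField, hσ, ← constBond_add_eq_bondGauge]
  have hW : fieldLink F (e / ((ℓ + 1) ^ k : ℕ)) (fun u v : ↥(Box d ℓ k M) => compField Ac u.1 v.1)
      = gaugeKer g g (fieldLink F 1 A') := by
    rw [fieldLink_smul, hfield, fieldLink_bondGauge]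
  have hTr : transport (fieldLink F (e / ((ℓ + 1) ^ k : ℕ)) (fun u v : ↥(Box d ℓ k M) => compField Ac u.1 v.1)) x l
      = g x * transport (fieldLink F 1 A') x l * (g x')ᵀ := by
    rw [hW, transport_gauge hg, hlend]
  have hDer : derivA d F (e / ((ℓ + 1) ^ k : ℕ)) ℓ k M (fun u v : ↥(Box d ℓ k M) => compField Ac u.1 v.1) μ
      = blockDiag g * derivA d F 1 ℓ k M A' μ * (blockDiag g)ᵀ := by
    unfold derivA
    rw [hW, covDeriv_gauge hg]
  have hGr : greenA d F (e / ((ℓ + 1) ^ k : ℕ)) ℓ k a m2 M (baseEmb hn M) (stairContour hn M)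
        (fun u v : ↥(Box d ℓ k M) => compField Ac u.1 v.1)
      = blockDiag g * greenA d F 1 ℓ k a m2 M (baseEmb hn M) (stairContour hn M) A' * (blockDiag g)ᵀ := by
    rw [greenA_smul, hfield]
    unfold greenA
    rw [b4Green_bondGauge F 1 _ m2 _ (fun y x hw => stairContour_end hn M y x hw) σ A']
  rw [hTr, hDer, hGr, holder_gauge hg]
  exact main

end

end Literature.MathematicalPhysics.QuantumFieldTheory.Balaban1983to89.B4Lemma22RegFieldDual
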